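import Mathlib
import Summits.HodgeConjecture.FermatCycles.HodgeFermatHypUPlusA

/-!
# LEMMA S⁺ — part 2: certificates at a general level, the walk `walkN` (`HodgeFermat/HypUPlus.lean`; HF-G26)

Tree copy (part 2 of 3) of the module `HodgeFermat/HypUPlus.lean` of the sibling cell's standalone package
`run/shared/lean/pub/pub-hodgefermat/lean/HodgeFermat/` (778 lines, sha256 `f3c5085dc93f3a67…`), source lines 317–628 (§3 certificates at a general level: factorisation lists `WF`/`valOf`/`totOf`, `tauP_le_of_pcBoundP`, `sum_le_of_sumBoundsP`, `certSqfP`, `certSkipP`, `stepN`, `NRange`, `walkN`).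
Filed by cell `pub-hfermat`, seat prover-1 gen-3, on the COORDINATOR KEEPER RULING of 2026-08-25 (gem sweep H1: take the
off-gate kernel theorem `thmFstar` through the gate) — here THEOREM F* of `tables/DPRIME-THEOREM.md` §9 IN FULL, i.e.
PROPOSITION D′(3N) and the descent (`HodgeFermat/PropDPrimeNFinal.lean`, GATE HF-G34), the last off-gate form of THEOREM F*
(its first two forms, `DecodingFinal.thmFstar` = F* at the prime levels and `ThmFstarNFinal.thmFstar` = F*(3N), landed on
2026-08-25 as `HodgeFermatThmFstar.lean` / `HodgeFermatThmFstarN.lean`, seats prover-1 gen-0 / gen-2); this file is one link of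
the import closure of `PropDPrimeNFinal.propDprime` (the sibling's KR-free chain: THEOREM L, COROLLARY M, THEOREM D6,
THEOREM U⁺, THEOREM KR6, THEOREM Z3U) on top of those landed chains.  The source module is the sibling's hub-checked module of
record (pub-hodgefermat `CERT.md` l.909, GATE HF-G26; cell record `check/HypUPlus_standalone.lean` sha256 `76158e6cd8cd311b…`); its declarations are copied VERBATIM.
Deviations from the source module, exhaustively: the `import` lines (tree modules `Summits.HodgeConjecture.FermatCycles.
HodgeFermat*` instead of `HodgeFermat.*`); this module docstring; the `set_option`/namespace/`open` preamble (source l.36–41) is repeated at the top because the module is split; one-line docstrings added (gate lint) to `valOf`, `totOf`, `wf_sound`, `WF.tail`, `WF.notMem`, `WF.filter`, `valOf_cons`, `totOf_cons`, `valOf_pos`, `coprime_valOf`, `totient_valOf`, `primeFactors_valOf`, `factorization_valOf`, `valOf_split`, `tauP_le_of_pcBoundP`, `sum_le_of_sumBoundsP`, `certSqfP_sound`, `certSkipP_sound`, `stepN_sound`, `nRange_append`, `nRange_mono`, `walkN_sound`. The module docstring is quoted in full in part 1.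
Every other line — in particular every declaration's statement and proof — is byte-identical to the source.
HONEST FRAMING: explicit algebraic cycles for specific Hodge classes on Fermat/Delsarte varieties; residual open instances
listed; no claim on general Hodge.  (This file is arithmetic of CM types / finite combinatorics / analytic number theory
of the sibling's KR-free programme; it claims nothing about cycles.)
-/

set_option autoImplicit false

namespace HodgeFermat.KRFree.HypUPlus

open Finset HodgeFermat.KRFree.HypBReduction HodgeFermat.KRFree.HypUCert HodgeFermat.KRFree.HypUAuto
open HodgeFermat.KRFree.HypUOdd

/-! ## §3 Certificates at a general level

The factor list `fs = [(p₁, e₁), …, (p_k, e_k)]` (distinct primes, exponents `≥ 1`) describes the level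
`valOf fs = ∏ pᵢ ^ eᵢ`; `totOf fs = ∏ pᵢ^(eᵢ-1) (pᵢ - 1)` is its totient, and the cofactor `n_p` of `p = pᵢ`
is `valOf` of the list without `(pᵢ, eᵢ)`. -/

/-- well-formedness: distinct primes, exponents `≥ 1`. -/
def wf (fs : List (ℕ × ℕ)) : Bool :=
  nodupB (fs.map Prod.fst) && fs.all (fun qe => isPrimeB qe.1 && Nat.ble 1 qe.2)

/-- the number encoded by a factorisation list -/
def valOf (fs : List (ℕ × ℕ)) : ℕ := (fs.map fun qe => qe.1 ^ qe.2).prod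

/-- the totient encoded by a factorisation list -/
def totOf (fs : List (ℕ × ℕ)) : ℕ := (fs.map fun qe => qe.1 ^ (qe.2 - 1) * (qe.1 - 1)).prod

/-- the Prop form of `wf`. -/
def WF (fs : List (ℕ × ℕ)) : Prop := (fs.map Prod.fst).Nodup ∧ ∀ qe ∈ fs, qe.1.Prime ∧ 1 ≤ qe.2

/-- soundness of the Boolean well-formedness test `wf` -/
theorem wf_sound (fs : List (ℕ × ℕ)) (h : wf fs = true) : WF fs := by
  simp only [wf, Bool.and_eq_true, List.all_eq_true, Nat.ble_eq] at h
  exact ⟨nodup_of_nodupB _ h.1, fun qe hqe => ⟨prime_of_isPrimeB _ (h.2 qe hqe).1, (h.2 qe hqe).2⟩⟩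

/-- the tail of a well-formed factorisation list is well-formed -/
theorem WF.tail {qe : ℕ × ℕ} {fs : List (ℕ × ℕ)} (h : WF (qe :: fs)) : WF fs :=
  ⟨(List.nodup_cons.mp (show (qe.1 :: fs.map Prod.fst).Nodup from h.1)).2,
    fun x hx => h.2 x (List.mem_cons_of_mem _ hx)⟩

/-- the head prime of a well-formed list does not recur -/
theorem WF.notMem {qe : ℕ × ℕ} {fs : List (ℕ × ℕ)} (h : WF (qe :: fs)) : qe.1 ∉ fs.map Prod.fst :=
  (List.nodup_cons.mp (show (qe.1 :: fs.map Prod.fst).Nodup from h.1)).1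

/-- filtering keeps a factorisation list well-formed -/
theorem WF.filter {fs : List (ℕ × ℕ)} (h : WF fs) (P : ℕ × ℕ → Bool) : WF (fs.filter P) :=
  ⟨List.Nodup.sublist (List.Sublist.map Prod.fst List.filter_sublist) h.1,
    fun x hx => h.2 x (List.mem_filter.mp hx).1⟩

/-- `valOf` of a cons -/
theorem valOf_cons (qe : ℕ × ℕ) (fs : List (ℕ × ℕ)) : valOf (qe :: fs) = qe.1 ^ qe.2 * valOf fs := by
  simp [valOf]

/-- `totOf` of a cons -/
theorem totOf_cons (qe : ℕ × ℕ) (fs : List (ℕ × ℕ)) :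
    totOf (qe :: fs) = qe.1 ^ (qe.2 - 1) * (qe.1 - 1) * totOf fs := by
  simp [totOf]

/-- `valOf` is positive for prime entries with positive exponents -/
theorem valOf_pos (fs : List (ℕ × ℕ)) (h : ∀ qe ∈ fs, qe.1.Prime ∧ 1 ≤ qe.2) : 0 < valOf fs :=
  List.prod_pos (fun x hx => by
    obtain ⟨qe, hqe, rfl⟩ := List.mem_map.mp hx
    exact pow_pos (h qe hqe).1.pos _)

/-- a prime absent from the list is prime to its `valOf` -/
theorem coprime_valOf (q : ℕ) (fs : List (ℕ × ℕ)) (hq : q.Prime)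
    (hfs : ∀ qe ∈ fs, qe.1.Prime ∧ 1 ≤ qe.2) (hnot : q ∉ fs.map Prod.fst) :
    Nat.Coprime q (valOf fs) := by
  unfold valOf
  rw [Nat.coprime_list_prod_right_iff]
  intro x hx
  obtain ⟨qe, hqe, rfl⟩ := List.mem_map.mp hx
  apply Nat.Coprime.pow_right
  exact (Nat.coprime_primes hq (hfs qe hqe).1).mpr
    (fun h => hnot (List.mem_map.mpr ⟨qe, hqe, h.symm⟩))

/-- `φ(valOf fs) = totOf fs` for well-formed lists -/
theorem totient_valOf : ∀ fs : List (ℕ × ℕ), WF fs → (valOf fs).totient = totOf fs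
  | [], _ => by simp [valOf, totOf]
  | qe :: fs, h => by
      have hq : qe.1.Prime := (h.2 qe (by simp)).1
      have he : 1 ≤ qe.2 := (h.2 qe (by simp)).2
      have hcop : Nat.Coprime (qe.1 ^ qe.2) (valOf fs) :=
        (coprime_valOf qe.1 fs hq h.tail.2 h.notMem).pow_left _
      rw [valOf_cons, totOf_cons, Nat.totient_mul hcop, Nat.totient_prime_pow hq he,
        totient_valOf fs h.tail]

/-- the prime factors of `valOf fs` are the listed primes -/
theorem primeFactors_valOf : ∀ fs : List (ℕ × ℕ), WF fs →
    (valOf fs).primeFactors = (fs.map Prod.fst).toFinset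
  | [], _ => by simp [valOf]
  | qe :: fs, h => by
      have hq : qe.1.Prime := (h.2 qe (by simp)).1
      have he : 1 ≤ qe.2 := (h.2 qe (by simp)).2
      have h0 : qe.1 ^ qe.2 ≠ 0 := (pow_pos hq.pos _).ne'
      have h1 : valOf fs ≠ 0 := (valOf_pos fs h.tail.2).ne'
      rw [valOf_cons, Nat.primeFactors_mul h0 h1, Nat.primeFactors_prime_pow (by omega) hq,
        primeFactors_valOf fs h.tail, List.map_cons, List.toFinset_cons, Finset.insert_eq]

/-- the factorisation of `valOf fs` is read off the list -/
theorem factorization_valOf : ∀ fs : List (ℕ × ℕ), WF fs →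
    ∀ qe ∈ fs, (valOf fs).factorization qe.1 = qe.2
  | [], _, qe, hqe => by simp at hqe
  | x :: fs, h, qe, hqe => by
      have hx : x.1.Prime := (h.2 x (by simp)).1
      have h0 : x.1 ^ x.2 ≠ 0 := (pow_pos hx.pos _).ne'
      have h1 : valOf fs ≠ 0 := (valOf_pos fs h.tail.2).ne'
      rw [valOf_cons, Nat.factorization_mul h0 h1, Finsupp.add_apply, hx.factorization_pow,
        Finsupp.single_apply]
      rcases List.mem_cons.mp hqe with rfl | hmem
      · have hndvd : ¬ qe.1 ∣ valOf fs := fun hdvd =>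
          hx.one_lt.ne' ((coprime_valOf qe.1 fs hx h.tail.2 h.notMem).eq_one_of_dvd hdvd)
        rw [if_pos rfl, Nat.factorization_eq_zero_of_not_dvd hndvd]
        rfl
      · have hne : x.1 ≠ qe.1 := fun e => h.notMem (List.mem_map.mpr ⟨qe, hmem, e.symm⟩)
        rw [if_neg hne, factorization_valOf fs h.tail qe hmem, zero_add]

/-- splitting `valOf` at one listed prime power -/
theorem valOf_split : ∀ fs : List (ℕ × ℕ), ∀ qe ∈ fs, (fs.map Prod.fst).Nodup →
    valOf fs = qe.1 ^ qe.2 * valOf (fs.filter (fun x => x.1 != qe.1))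
  | [], qe, hqe, _ => by simp at hqe
  | x :: fs, qe, hqe, hnd => by
      have hnd1 := List.nodup_cons.mp (show (x.1 :: fs.map Prod.fst).Nodup from hnd)
      rcases List.mem_cons.mp hqe with rfl | hmem
      · have hkeep : fs.filter (fun y => y.1 != qe.1) = fs := by
          rw [List.filter_eq_self]
          intro y hy
          have : y.1 ≠ qe.1 := fun e => hnd1.1 (List.mem_map.mpr ⟨y, hy, e⟩)
          simpa using this
        rw [valOf_cons, List.filter_cons_of_neg (by simp), hkeep]
      · have hne : x.1 ≠ qe.1 := fun e => hnd1.1 (e ▸ List.mem_map.mpr ⟨qe, hmem, rfl⟩)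
        rw [valOf_cons, List.filter_cons_of_pos (by simpa using hne), valOf_cons,
          valOf_split fs qe hmem hnd1.2]
        ring

/-- the certified bound for `tauP N p` at the factor `(p, e) ∈ fs` of `N = valOf fs` (`m = n_p`). -/
def pcBoundP (N : ℕ) (fs : List (ℕ × ℕ)) (qe : ℕ × ℕ) (c : PC) : Option ℕ :=
  if c.neg != 0 then
    (if powMod qe.1 c.neg (N / qe.1 ^ qe.2) == (N / qe.1 ^ qe.2 - 1) % (N / qe.1 ^ qe.2) then some 0
     else none)
  else if checkOrd qe.1 (N / qe.1 ^ qe.2) c.d c.fac then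
    some (totOf (fs.filter (fun x => x.1 != qe.1)) / c.d)
  else none

/-- a checked certificate bounds `tauP N p` -/
theorem tauP_le_of_pcBoundP (N : ℕ) (fs : List (ℕ × ℕ)) (qe : ℕ × ℕ) (c : PC) (b : ℕ)
    (hW : WF fs) (hN : valOf fs = N) (hqe : qe ∈ fs) (h : pcBoundP N fs qe c = some b) :
    tauP N qe.1 ≤ b := by
  have hq : qe.1.Prime := (hW.2 qe hqe).1
  have hfac : N.factorization qe.1 = qe.2 := hN ▸ factorization_valOf fs hW qe hqe
  have hm : npart N qe.1 = N / qe.1 ^ qe.2 := by rw [npart, hfac]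
  have hWr : WF (fs.filter (fun x => x.1 != qe.1)) := hW.filter _
  have hrest : N / qe.1 ^ qe.2 = valOf (fs.filter (fun x => x.1 != qe.1)) :=
    Nat.div_eq_of_eq_mul_right (pow_pos hq.pos _)
      (by rw [← hN, valOf_split fs qe hqe hW.1])
  have hm1 : 1 ≤ N / qe.1 ^ qe.2 := by rw [hrest]; exact valOf_pos _ hWr.2
  unfold pcBoundP at h
  split_ifs at h with hneg hA hB
  · -- type A: `p ^ neg ≡ -1 (mod n_p)`
    simp only [beq_iff_eq, powMod_eq] at hA
    have hcast : ((qe.1 : ℕ) : ZMod (N / qe.1 ^ qe.2)) ^ c.neg = -1 := by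
      have h1 : ((qe.1 ^ c.neg : ℕ) : ZMod (N / qe.1 ^ qe.2)) =
          ((N / qe.1 ^ qe.2 - 1 : ℕ) : ZMod (N / qe.1 ^ qe.2)) :=
        (ZMod.natCast_eq_natCast_iff' _ _ _).mpr hA
      rw [Nat.cast_pow, Nat.cast_sub hm1, ZMod.natCast_self, Nat.cast_one, zero_sub] at h1
      exact h1
    have ht : tauP N qe.1 = 0 := by
      rw [tauP, hm, tauAt, if_pos ⟨c.neg, hcast⟩]
    cases h
    omega
  · -- type B: exact order
    cases h
    have hord := checkOrd_sound _ _ _ _ hB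
    have htot : (N / qe.1 ^ qe.2).totient = totOf (fs.filter (fun x => x.1 != qe.1)) := by
      rw [hrest]; exact totient_valOf _ hWr
    rw [tauP, hm, tauAt]
    split_ifs with hex
    · exact Nat.zero_le _
    · rw [htot, hord]

/-- sum of the certified bounds along the factor list (certificates aligned with `fs`). -/
def sumBoundsP (N : ℕ) (fs : List (ℕ × ℕ)) : List (ℕ × ℕ) → List PC → Option ℕ
  | [], _ => some 0
  | qe :: rest, c :: cs =>
      match pcBoundP N fs qe c, sumBoundsP N fs rest cs with
      | some b, some s => some (b + s)
      | _, _ => none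
  | _ :: _, [] => none

/-- Check a general level: `fs` well formed with `valOf fs = N`, one certificate per factor (same order),
and `6 · (sum of bounds) < totOf fs = φ(N)`. -/
def checkLevelP (N : ℕ) (fs : List (ℕ × ℕ)) (pcs : List PC) : Bool :=
  wf fs && (valOf fs == N) &&
    (match sumBoundsP N fs fs pcs with
     | some s => Nat.blt (6 * s) (totOf fs)
     | none => false)

/-- the certified bounds sum to an upper bound for `Σ tauP` -/
theorem sum_le_of_sumBoundsP (N : ℕ) (fs : List (ℕ × ℕ)) (hW : WF fs) (hN : valOf fs = N) :
    ∀ (gs : List (ℕ × ℕ)) (pcs : List PC) (s : ℕ), (∀ qe ∈ gs, qe ∈ fs) →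
    sumBoundsP N fs gs pcs = some s → ((gs.map Prod.fst).map (tauP N)).sum ≤ s
  | [], _, s, _, _ => by simp
  | qe :: rest, c :: cs, s, hmem, h => by
      simp only [sumBoundsP] at h
      split at h
      · rename_i b s' hb hs'
        cases h
        simp only [List.map_cons, List.sum_cons]
        exact Nat.add_le_add (tauP_le_of_pcBoundP N fs qe c b hW hN (hmem qe (by simp)) hb)
          (sum_le_of_sumBoundsP N fs hW hN rest cs s' (fun x hx => hmem x (by simp [hx])) hs')
      · exact absurd h (by simp)
  | _ :: _, [], s, _, h => by simp [sumBoundsP] at h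

/-- SOUNDNESS of the general level certificate. -/
theorem goodP_of_checkLevelP (N : ℕ) (fs : List (ℕ × ℕ)) (pcs : List PC)
    (h : checkLevelP N fs pcs = true) : GoodP N := by
  simp only [checkLevelP, Bool.and_eq_true, beq_iff_eq] at h
  obtain ⟨⟨hwf, hN⟩, hfin⟩ := h
  have hW := wf_sound fs hwf
  split at hfin
  · rename_i s hs
    simp only [Nat.blt_eq] at hfin
    have hle := sum_le_of_sumBoundsP N fs hW hN fs pcs s (fun _ h => h) hs
    have hpf : N.primeFactors = (fs.map Prod.fst).toFinset := hN ▸ primeFactors_valOf fs hW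
    have htot : N.totient = totOf fs := hN ▸ totient_valOf fs hW
    have hle' : ((fs.map Prod.fst).map (fun p => tauP N p)).sum ≤ s := hle
    unfold GoodP
    rw [hpf, List.sum_toFinset _ hW.1, htot]
    calc 6 * ((fs.map Prod.fst).map (fun p => tauP N p)).sum ≤ 6 * s := Nat.mul_le_mul_left 6 hle'
      _ < totOf fs := hfin
  · exact absurd hfin (by simp)

/-! ## §4 The generator, the step, the walk -/

/-- `λ(n_p) = lcm` of `q^(f-1) (q-1)` over the other prime powers `(q, f)` of the level (odd level). -/
def lamP (p : ℕ) (fs : List (ℕ × ℕ)) : ℕ :=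
  (fs.filter (fun x => x.1 != p)).foldl (fun acc x => Nat.lcm acc (x.1 ^ (x.2 - 1) * (x.1 - 1))) 1

/-- the certificate for `p` modulo `m = n_p` (unverified: validated by `checkLevelP`): linear search for the
first `p ^ j ≡ ∓1` (`j ≤ 64`), else the exact order reduced from `λ(n_p)`. -/
def autoPCP (fs : List (ℕ × ℕ)) (p m : ℕ) : PC :=
  match linSearch p m 64 1 (p % m) with
  | some c => c
  | none => lamPCOf p m (lamP p fs)

/-- the certificates of the level `N = valOf fs`, aligned with `fs`. -/
def certsP (N : ℕ) (fs : List (ℕ × ℕ)) : List PC :=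
  fs.map (fun qe => autoPCP fs qe.1 (N / qe.1 ^ qe.2))

/-- certified squarefree: well-formed factor list of `n` with all exponents `1`. -/
def certSqfP (n : ℕ) (fs : List (ℕ × ℕ)) : Bool :=
  wf fs && (valOf fs == n) && fs.all (fun x => x.2 == 1)

/-- soundness of the squarefreeness certificate `certSqfP` -/
theorem certSqfP_sound (n : ℕ) (fs : List (ℕ × ℕ)) (h : certSqfP n fs = true) : Squarefree n := by
  simp only [certSqfP, Bool.and_eq_true, beq_iff_eq, List.all_eq_true] at h
  obtain ⟨⟨hwf, hN⟩, hall⟩ := h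
  have hW := wf_sound fs hwf
  have hn0 : n ≠ 0 := hN ▸ (valOf_pos fs hW.2).ne'
  rw [Nat.squarefree_iff_factorization_le_one hn0]
  intro p
  by_cases hp : p ∈ fs.map Prod.fst
  · obtain ⟨qe, hqe, rfl⟩ := List.mem_map.mp hp
    rw [← hN, factorization_valOf fs hW qe hqe]
    exact (hall qe hqe).le
  · have hnot : p ∉ n.primeFactors := by
      rw [← hN, primeFactors_valOf fs hW, List.mem_toFinset]; exact hp
    by_cases hpp : p.Prime
    · rw [Nat.factorization_eq_zero_of_not_dvd
        (fun hdvd => hnot (Nat.mem_primeFactors.mpr ⟨hpp, hdvd, hn0⟩))]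
      exact Nat.zero_le _
    · rw [Nat.factorization_eq_zero_of_not_prime n hpp]
      exact Nat.zero_le _

/-- certified skip: well-formed factor list of `n` and `n` beyond the tail threshold of its length. -/
def certSkipP (n : ℕ) (fs : List (ℕ × ℕ)) : Bool :=
  wf fs && (valOf fs == n) && Nat.blt (XK fs.length) n

/-- soundness of the skip certificate `certSkipP` -/
theorem certSkipP_sound (n : ℕ) (fs : List (ℕ × ℕ)) (h : certSkipP n fs = true) :
    XK n.primeFactors.card < n := by
  simp only [certSkipP, Bool.and_eq_true, beq_iff_eq, Nat.blt_eq] at h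
  obtain ⟨⟨hwf, hN⟩, hlt⟩ := h
  have hW := wf_sound fs hwf
  have hpf : n.primeFactors = (fs.map Prod.fst).toFinset := hN ▸ primeFactors_valOf fs hW
  rw [hpf, List.toFinset_card_of_nodup hW.1, List.length_map]
  exact hlt

/-- one level, given its (unverified) factor list. -/
def stepNOf (n : ℕ) (fs : List (ℕ × ℕ)) : Bool :=
  certSqfP n fs || (certSkipP n fs || checkLevelP n fs (certsP n fs))

/-- one level: certified squarefree (nothing to prove), certified beyond the threshold (the tail), or the
generated certificate checks. -/
def stepN (n : ℕ) : Bool := stepNOf n (factor n)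

/-- a non-squarefree odd level passing `stepN` is `GoodP` -/
theorem stepN_sound (n : ℕ) (h : stepN n = true) (h2 : ¬ 2 ∣ n) (hns : ¬ Squarefree n) : GoodP n := by
  simp only [stepN, stepNOf, Bool.or_eq_true] at h
  rcases h with h | h | h
  · exact absurd (certSqfP_sound n _ h) hns
  · exact goodTailP n h2 (certSkipP_sound n _ h)
  · exact goodP_of_checkLevelP n _ _ h

/-- the statement certified by the walk: every NON-squarefree odd `N ∈ [a, b)` satisfies the level inequality. -/
def NRange (a b : ℕ) : Prop := ∀ N, a ≤ N → N < b → ¬ 2 ∣ N → ¬ Squarefree N → GoodP N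

/-- glue two adjacent `NRange`s -/
theorem nRange_append {a b c : ℕ} (h₁ : NRange a b) (h₂ : NRange b c) : NRange a c :=
  fun N ha hc h2 hns =>
    if hb : N < b then h₁ N ha hb h2 hns else h₂ N (Nat.le_of_not_lt hb) hc h2 hns

/-- shrink the upper end of an `NRange` -/
theorem nRange_mono {a b b' : ℕ} (h : NRange a b) (hb : b' ≤ b) : NRange a b' :=
  fun N ha hc h2 hns => h N ha (lt_of_lt_of_le hc hb) h2 hns

/-- Walk `N = top - fuel, …, top - 1` through `stepN`, skipping the even `N`. -/
def walkN (top : ℕ) : ℕ → Bool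
  | 0 => true
  | fuel + 1 =>
      if (top - (fuel + 1)) % 2 = 0 then walkN top fuel
      else stepN (top - (fuel + 1)) && walkN top fuel

/-- soundness of the walk `walkN` -/
theorem walkN_sound (top : ℕ) : ∀ fuel : ℕ, walkN top fuel = true →
    ∀ n, top - fuel ≤ n → n < top → ¬ 2 ∣ n → ¬ Squarefree n → GoodP n
  | 0, _, n, h1, h2, _, _ => by omega
  | fuel + 1, h, n, h1, h2, h2n, hns => by
      unfold walkN at h
      split_ifs at h with hdiv
      · rcases Nat.eq_or_lt_of_le h1 with heq | hlt
        · exfalso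
          rw [heq] at hdiv
          exact h2n (Nat.dvd_of_mod_eq_zero hdiv)
        · exact walkN_sound top fuel h n (by omega) h2 h2n hns
      · simp only [Bool.and_eq_true] at h
        rcases Nat.eq_or_lt_of_le h1 with heq | hlt
        · rw [heq] at h
          exact stepN_sound n h.1 h2n hns
        · exact walkN_sound top fuel h.2 n (by omega) h2 h2n hns

/-- The range statement `NRange a (a + k)` from a checked walk. -/
theorem nRange_of_walkN (a k : ℕ) (hw : walkN (a + k) k = true) : NRange a (a + k) :=
  fun n ha hb h2 hns => walkN_sound (a + k) k hw n (by omega) hb h2 hns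


end HodgeFermat.KRFree.HypUPlus
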